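/-
Copyright (c) 2026. All rights reserved.
Released under Apache 2.0 license as described in the file LICENSE.
-/
import Summits.HodgeConjecture.HodgeConjecture.Theorems.K2LiuArchLadderRungTransfer        -- ★ G6-arch asm FILE 2 (brings ★ (A∞) value files, ★ Shilov coordinate, ★ asm FILE 1)
import Summits.HodgeConjecture.HodgeConjecture.Theorems.K2LiuArchIntertwiningScalarValue   -- ★ (A∞-B) `integrand_eq`, `integral_hermOfReal_eq`, the `det(1 ∓ iX)` letters
import HarnessLib

/-!
# Crux `HLiu418`, G6-arch ASSEMBLY FILE 5: THE ONE-DIMENSIONAL ANCHORS — for EVERY `m : ℤ` the section of `I_w(s,χ_k)` with compact picture `D^m`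
# and the value of `M_w(s)` on it: `c_{k,m}(s) = (1∕8)·ξ(1,0; s+1−k∕2−m, s+1+k∕2+m) = (π⁴∕2)·e^{iπ(k+2m)}·Γ₂(s+1−k∕2−m)⁻¹Γ₂(s+1+k∕2+m)⁻¹·Γ₂(2s)·4^{−2s}`

Cell `hodgecm-mathlib`, crux item hLiu418 = `stmt-HodgeConjecture-24832` (helper lane `--supports`, count-neutral).

WHY (numbers, not taste).  The ladder ★ asm FILES 2–4 climbs from an ANCHOR type where the scalar of `M_w(s)` is known by an integral.  ★ (A∞-R) gives ONE anchor per
character, the weight-`k` scalar vector `f⁰_{s,k}` (type `(0, −k)`); from it the CLEAN eigen-arrows `M₀₀ = +e₁`, `P₁₁ = −e₂` (★ S2-T on highest-weight vectors) reach only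
`{λ₂ ≤ −k ≤ λ₁}`, and the other arrows straddle two types.  With the one-dimensional type `(0, m)` as anchor for EVERY `m`, the type `(k′, l′)` is reached from `(0, l′)` by
`k′` clean `M₀₀`-arrows (or from `(0, k′+l′)` by `k′` clean `P₁₁`-arrows) — no projector words are needed anywhere.  The anchor section is EXPLICIT:
`F_{k,m}(h) := f⁰_{s,k}(h) · (j(h,i)∕j(h,−i))^{k+m}`, `j(h, ±i) = det (denom h (±i·1))` (`j(h,i)∕j(h,−i) = det v_h`, the Shilov coordinate ★ `K2LiuU22ShilovCoordinate`), and
`M_w(s)F_{k,m}(1)` is Shimura's `ξ(1, 0; α, β)` with the SHIFTED exponents `α = s+1−k∕2−m`, `β = s+1+k∕2+m` (`α+β = 2s+2` unchanged), whose closed form for `re(α+β) > 3`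
is ★ `xiTwo_zero_right` (general `α, β`).
* §1 `det_hermTwo_sub_I_smul_one` (`det(X − i) = −det(1 + iX)`), **`xiTwoIntegrand_mul_ratio_zpow`** (`ξ-integrand(α,β) · (det(X+i)∕det(X−i))^t = ξ-integrand(α−t, β+t)`, `t : ℤ`).
* §2 the ratio `j(h,i)∕j(h,−i)`: invariant under the Siegel parabolic on the left (`ratio_siegel_mul`), multiplied by `det u` under `k_u` on the right (`ratio_mul_kU`),
  `= det v` at `k_v` (`ratio_kU`), `= det(X+i)∕det(X−i)` at `J·n(X)` (`ratio_J_transl`).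
* §3 **`isArchSiegelSection_oneDim`**, **`oneDim_kU`** (`cp F_{k,m} = D^m`), `oneDim_mul_kU` (right `K_w`-character `det u^m` on `U(J)`),
  **`archIntertwining_oneDim_one`** (`M_w F_{k,m}(1) = (1∕8)·ξ(1,0; s+1−k∕2−m, s+1+k∕2+m)`, all `s`), `archIntertwining_oneDim_kU` (`M_w F_{k,m}(k_u) = det u^m · M_w F_{k,m}(1)`).
* §4 **`oneDim_anchor`** — `re s > ½`: `∃ F ∈ I_w(s,χ_k)` with `cp F = D^m` and `cp M_w(s) F = c_{k,m}(s) • D^m`, `c_{k,m}(s)` the closed form above — the anchor triple of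
  ★ asm FILE 2 `ladder` ∕ FILE 4 `ladder_pair` at the type `(0, m)` (`m = −k` is ★ `anchor`).
References: [Shimura1982, (1.16), (1.25), (1.31), Case II, m = 2]; [Shimura1997, §16.4]; [LeeZhu1998, §5]; [Knapp1986, Ch. VII §1].
HONEST LABEL: HC_CM is proved only modulo the 7 printed citations (2 remaining named inputs: hLiu418 = stmt-HodgeConjecture-24832,
h413 = stmt-HodgeConjecture-24833) until rung 0 closes; count-neutral helper, closes no socket.
-/

set_option autoImplicit false
set_option linter.dupNamespace false

noncomputable section

open Complex Matrix MeasureTheory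
open scoped ComplexConjugate ComplexOrder

namespace Summit.HodgeConjecture.HodgeConjecture.Cruxes.HLiu418.K2LiuArchOneDimAnchors

open Literature.NumberTheory.ModularForms.SiegelUpperHalfSpace (num denom moeb num_def denom_def moeb_def denom_mul denom_mul_eq)
open Summit.HodgeConjecture.HodgeConjecture.Cruxes.HLiu418.K2LiuHermTwoGammaDefs
open Summit.HodgeConjecture.HodgeConjecture.Cruxes.HLiu418.K2LiuHermTwoConfluentXiDefs
open Summit.HodgeConjecture.HodgeConjecture.Cruxes.HLiu418.K2LiuHermTwoXiZeroValue (xiTwo_zero_right)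
open Summit.HodgeConjecture.HodgeConjecture.Cruxes.HLiu418.K2LiuArchInducedTubeDefs
open Summit.HodgeConjecture.HodgeConjecture.Cruxes.HLiu418.K2LiuArchInducedTubeSection (isArchSiegelSection_archScalarSection archScalarSection_mul_stab denom_J_mul_transl denom_J_mul_transl_one)
open Summit.HodgeConjecture.HodgeConjecture.Cruxes.HLiu418.K2LiuArchIntertwiningScalarValue (integrand_eq integral_hermOfReal_eq det_one_sub_I_smul_hermTwo_mem_slitPlane det_one_add_I_smul_hermTwo det_hermTwo_add_I_smul_one)
open Summit.HodgeConjecture.HodgeConjecture.Cruxes.HLiu418.K2LiuU22ShilovCoordinate (kU_mem_UJ denom_kU_I denom_kU_negI num_kU_negI moeb_kU_I)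
open Summit.HodgeConjecture.HodgeConjecture.Cruxes.HLiu418.K2LiuU22CompactPictureDefs
open Summit.HodgeConjecture.HodgeConjecture.Cruxes.HLiu418.K2LiuArchSWOnePlaceRegion (evalAt_dz det_ne_zero_of_unitary)
open Summit.HodgeConjecture.HodgeConjecture.Cruxes.HLiu418.K2LiuArchIntertwiningSiegelLaw (siegel_decomposition)
open Summit.HodgeConjecture.HodgeConjecture.Cruxes.HLiu418.K2LiuArchKFiniteSectionMajorised (archScalarSection_kU)

/-! ## §1  The shifted `ξ`-integrand -/

/-- `X − i·1 = −i · (1 + iX)`, hence `det(X − i) = −det(1 + iX)` (`2 × 2`). [folklore] -/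
theorem det_hermTwo_sub_I_smul_one (c : ℝ × ℂ × ℝ) :
    (hermTwo c - I • (1 : Matrix (Fin 2) (Fin 2) ℂ)).det = -((1 : Matrix (Fin 2) (Fin 2) ℂ) + I • hermTwo c).det := by
  have h : hermTwo c - I • (1 : Matrix (Fin 2) (Fin 2) ℂ) = (-I) • ((1 : Matrix (Fin 2) (Fin 2) ℂ) + I • hermTwo c) := by
    rw [smul_add, smul_smul, neg_mul, I_mul_I, neg_neg, one_smul, neg_smul, sub_eq_add_neg, add_comm]
  rw [h, det_smul, Fintype.card_fin, neg_sq, I_sq, neg_one_mul]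

/-- **THE SHIFT**: `ξ-integrand(1,0;α,β)(X) · (det(X+i)∕det(X−i))^t = ξ-integrand(1,0;α−t,β+t)(X)` for `t : ℤ` (`det(X+i)∕det(X−i) = D∕D̄`, `D = det(1−iX) ∈ ℂ ∖ (−∞,0]`,
`D̄ = det(1+iX)`; integer powers commute with the principal branches, and `e^{−iπ(α−t)}e^{iπ(β+t)} = e^{−iπα}e^{iπβ}`). [Shimura1982, (1.25)] -/
theorem xiTwoIntegrand_mul_ratio_zpow (α β : ℂ) (t : ℤ) (c : ℝ × ℂ × ℝ) :
    xiTwoIntegrand 1 0 α β c * ((hermTwo c + I • (1 : Matrix (Fin 2) (Fin 2) ℂ)).det / (hermTwo c - I • (1 : Matrix (Fin 2) (Fin 2) ℂ)).det) ^ t =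
      xiTwoIntegrand 1 0 (α - t) (β + t) c := by
  set D : ℂ := ((1 : Matrix (Fin 2) (Fin 2) ℂ) - I • hermTwo c).det with hD
  have hDs : D ∈ slitPlane := det_one_sub_I_smul_hermTwo_mem_slitPlane c
  have hD0 : D ≠ 0 := (mem_slitPlane_iff_arg.mp hDs).2
  have hDπ : D.arg ≠ Real.pi := (mem_slitPlane_iff_arg.mp hDs).1
  have hDc0 : conj D ≠ 0 := (map_ne_zero _).mpr hD0
  rw [xiTwoIntegrand_apply, xiTwoIntegrand_apply, det_hermTwo_add_I_smul_one, det_hermTwo_sub_I_smul_one, det_one_add_I_smul_hermTwo, ← hD,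
    neg_div_neg_eq, Matrix.zero_mul, Matrix.trace_zero, mul_zero, Complex.exp_zero, one_mul, one_mul]
  have e3 : D ^ (-α) = cexp (Complex.log D * (-α)) := Complex.cpow_def_of_ne_zero hD0 _
  have e3' : D ^ (-(α - t)) = cexp (Complex.log D * (-(α - t))) := Complex.cpow_def_of_ne_zero hD0 _
  have e4 : (conj D) ^ (-β) = cexp (conj (Complex.log D) * (-β)) := by
    rw [Complex.cpow_def_of_ne_zero hDc0, Complex.log_conj_eq_ite, if_neg hDπ]
  have e4' : (conj D) ^ (-(β + t)) = cexp (conj (Complex.log D) * (-(β + t))) := by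
    rw [Complex.cpow_def_of_ne_zero hDc0, Complex.log_conj_eq_ite, if_neg hDπ]
  have e5 : (D / conj D) ^ t = cexp (Complex.log D * t) * cexp (-(conj (Complex.log D) * t)) := by
    rw [div_zpow, ← Complex.cpow_intCast, ← Complex.cpow_intCast, Complex.cpow_def_of_ne_zero hD0, Complex.cpow_def_of_ne_zero hDc0,
      Complex.log_conj_eq_ite, if_neg hDπ, div_eq_mul_inv, ← Complex.exp_neg]
  rw [e3, e3', e4, e4', e5]
  simp only [← Complex.exp_add, mul_assoc]
  rw [Complex.exp_eq_exp_iff_exists_int]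
  refine ⟨-t, ?_⟩
  push_cast
  ring

/-! ## §2  The ratio `j(h, i) ∕ j(h, −i)` -/

/-- the ratio is invariant under the Siegel parabolic on the left: `j(pg,±i) = det p₂₂ · j(g,±i)`, `det p₂₂ ≠ 0`. [Shimura1997, §5.2] -/
theorem ratio_siegel_mul {p : Matrix (Fin 2 ⊕ Fin 2) (Fin 2 ⊕ Fin 2) ℂ} (hp : pᴴ * Matrix.J (Fin 2) ℂ * p = Matrix.J (Fin 2) ℂ) (hp21 : p.toBlocks₂₁ = 0) (g : Matrix (Fin 2 ⊕ Fin 2) (Fin 2 ⊕ Fin 2) ℂ) :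
    ((denom (p * g) (I • (1 : Matrix (Fin 2) (Fin 2) ℂ))).det / (denom (p * g) (-(I • (1 : Matrix (Fin 2) (Fin 2) ℂ)))).det) = ((denom g (I • (1 : Matrix (Fin 2) (Fin 2) ℂ))).det / (denom g (-(I • (1 : Matrix (Fin 2) (Fin 2) ℂ)))).det) := by
  rw [denom_mul p g (I • (1 : Matrix (Fin 2) (Fin 2) ℂ)), denom_mul p g (-(I • (1 : Matrix (Fin 2) (Fin 2) ℂ))), hp21, Matrix.zero_mul, zero_add, Matrix.zero_mul, zero_add, det_mul, det_mul,
    mul_div_mul_left _ _ (siegel_decomposition hp hp21).2.1]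

/-- under `k_u` on the right the ratio picks up `det u` (`denom k_u (i1) = u`, `denom k_u (−i1) = 1`, `k_u` fixes `±i·1`). [Shimura1997, §6] -/
theorem ratio_mul_kU (x : Matrix (Fin 2 ⊕ Fin 2) (Fin 2 ⊕ Fin 2) ℂ) {u : Matrix (Fin 2) (Fin 2) ℂ} (hu : uᴴ * u = 1) :
    ((denom (x * ((2 : ℂ)⁻¹ • fromBlocks (1 + u) (-(I • (1 - u))) (I • (1 - u)) (1 + u) : Matrix (Fin 2 ⊕ Fin 2) (Fin 2 ⊕ Fin 2) ℂ)) (I • (1 : Matrix (Fin 2) (Fin 2) ℂ))).det / (denom (x * ((2 : ℂ)⁻¹ • fromBlocks (1 + u) (-(I • (1 - u))) (I • (1 - u)) (1 + u) : Matrix (Fin 2 ⊕ Fin 2) (Fin 2 ⊕ Fin 2) ℂ)) (-(I • (1 : Matrix (Fin 2) (Fin 2) ℂ)))).det) = ((denom x (I • (1 : Matrix (Fin 2) (Fin 2) ℂ))).det / (denom x (-(I • (1 : Matrix (Fin 2) (Fin 2) ℂ)))).det) * u.det := by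
  have hu' : IsUnit u.det := isUnit_iff_ne_zero.2 (det_ne_zero_of_unitary hu)
  have h1 : denom (x * ((2 : ℂ)⁻¹ • fromBlocks (1 + u) (-(I • (1 - u))) (I • (1 - u)) (1 + u) : Matrix (Fin 2 ⊕ Fin 2) (Fin 2 ⊕ Fin 2) ℂ)) (I • (1 : Matrix (Fin 2) (Fin 2) ℂ)) = denom x (I • (1 : Matrix (Fin 2) (Fin 2) ℂ)) * u := by
    rw [denom_mul_eq (by rw [denom_kU_I]; exact hu'), moeb_kU_I hu', denom_kU_I]
  have hm : moeb ((2 : ℂ)⁻¹ • fromBlocks (1 + u) (-(I • (1 - u))) (I • (1 - u)) (1 + u) : Matrix (Fin 2 ⊕ Fin 2) (Fin 2 ⊕ Fin 2) ℂ) (-(I • (1 : Matrix (Fin 2) (Fin 2) ℂ))) = -(I • (1 : Matrix (Fin 2) (Fin 2) ℂ)) := by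
    rw [moeb_def, num_kU_negI, denom_kU_negI, inv_one, Matrix.mul_one]
  have h2 : denom (x * ((2 : ℂ)⁻¹ • fromBlocks (1 + u) (-(I • (1 - u))) (I • (1 - u)) (1 + u) : Matrix (Fin 2 ⊕ Fin 2) (Fin 2 ⊕ Fin 2) ℂ)) (-(I • (1 : Matrix (Fin 2) (Fin 2) ℂ))) = denom x (-(I • (1 : Matrix (Fin 2) (Fin 2) ℂ))) := by
    rw [denom_mul_eq (by rw [denom_kU_negI, det_one]; exact isUnit_one), hm, denom_kU_negI, Matrix.mul_one]
  rw [h1, h2, det_mul, mul_div_right_comm]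

/-- at `k_v` the ratio is `det v`. [Shimura1997, §6] -/
theorem ratio_kU (v : Matrix (Fin 2) (Fin 2) ℂ) : ((denom ((2 : ℂ)⁻¹ • fromBlocks (1 + v) (-(I • (1 - v))) (I • (1 - v)) (1 + v) : Matrix (Fin 2 ⊕ Fin 2) (Fin 2 ⊕ Fin 2) ℂ) (I • (1 : Matrix (Fin 2) (Fin 2) ℂ))).det / (denom ((2 : ℂ)⁻¹ • fromBlocks (1 + v) (-(I • (1 - v))) (I • (1 - v)) (1 + v) : Matrix (Fin 2 ⊕ Fin 2) (Fin 2 ⊕ Fin 2) ℂ) (-(I • (1 : Matrix (Fin 2) (Fin 2) ℂ)))).det) = v.det := by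
  rw [denom_kU_I, denom_kU_negI, det_one, div_one]

/-- at the big-cell point `J·n(X)` the ratio is `det(X + i) ∕ det(X − i)`. [Shimura1997, §5.2] -/
theorem ratio_J_transl (X : Matrix (Fin 2) (Fin 2) ℂ) :
    ((denom (Matrix.J (Fin 2) ℂ * fromBlocks 1 X 0 1 * 1) (I • (1 : Matrix (Fin 2) (Fin 2) ℂ))).det / (denom (Matrix.J (Fin 2) ℂ * fromBlocks 1 X 0 1 * 1) (-(I • (1 : Matrix (Fin 2) (Fin 2) ℂ)))).det) = (X + I • (1 : Matrix (Fin 2) (Fin 2) ℂ)).det / (X - I • (1 : Matrix (Fin 2) (Fin 2) ℂ)).det := by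
  have h : denom (Matrix.J (Fin 2) ℂ * fromBlocks 1 X 0 1 * 1) (-(I • (1 : Matrix (Fin 2) (Fin 2) ℂ))) = X - I • (1 : Matrix (Fin 2) (Fin 2) ℂ) := by
    rw [denom_J_mul_transl, num_def, denom_def, ← fromBlocks_one, toBlocks_fromBlocks₁₁, toBlocks_fromBlocks₁₂, toBlocks_fromBlocks₂₁,
      toBlocks_fromBlocks₂₂, Matrix.one_mul, add_zero, Matrix.zero_mul, zero_add, Matrix.mul_one, neg_add_eq_sub]
  rw [denom_J_mul_transl_one, h]

/-! ## §3  The one-dimensional section `F_{k,m} = f⁰_{s,k} · (j(·,i)∕j(·,−i))^{k+m}` -/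

/-- **`F_{k,m} ∈ I_w(s, χ_k)`** (the ratio is left-`P`-invariant, ★ (A∞-0) for `f⁰_{s,k}`). [Shimura1997, §16.4] -/
theorem isArchSiegelSection_oneDim (k m : ℤ) (s : ℂ) :
    IsArchSiegelSection (fun z : ℂ => (conj z / ((‖z‖ : ℝ) : ℂ)) ^ k) s (fun h : Matrix (Fin 2 ⊕ Fin 2) (Fin 2 ⊕ Fin 2) ℂ => archScalarSection k s h * ((denom h (I • (1 : Matrix (Fin 2) (Fin 2) ℂ))).det / (denom h (-(I • (1 : Matrix (Fin 2) (Fin 2) ℂ)))).det) ^ (k + m)) := by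
  intro p g hp hp21
  beta_reduce
  rw [isArchSiegelSection_archScalarSection k s p g hp hp21, ratio_siegel_mul hp hp21]
  ring

/-- **`cp F_{k,m} = D^m`**: `F_{k,m}(k_v) = det v^{−k} · det v^{k+m} = ev_v (D^m)`. [Shimura1997, §16.4] -/
theorem oneDim_kU (k m : ℤ) (s : ℂ) {v : Matrix (Fin 2) (Fin 2) ℂ} (hv : vᴴ * v = 1) (hv' : v.det ≠ 0) :
    (fun h : Matrix (Fin 2 ⊕ Fin 2) (Fin 2 ⊕ Fin 2) ℂ => archScalarSection k s h * ((denom h (I • (1 : Matrix (Fin 2) (Fin 2) ℂ))).det / (denom h (-(I • (1 : Matrix (Fin 2) (Fin 2) ℂ)))).det) ^ (k + m)) ((2 : ℂ)⁻¹ • fromBlocks (1 + v) (-(I • (1 - v))) (I • (1 - v)) (1 + v) : Matrix (Fin 2 ⊕ Fin 2) (Fin 2 ⊕ Fin 2) ℂ) = evalAt v hv' (dz m) := by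
  beta_reduce
  rw [archScalarSection_kU k s hv, ratio_kU, evalAt_dz, ← zpow_add₀ hv']
  congr 1
  ring

/-- right `K_w`-character on `U(J)`: `F_{k,m}(x·k_u) = det u^m · F_{k,m}(x)` for `x ∈ U(J)`, `u` unitary (★ `archScalarSection_mul_stab` + §2). [Shimura1997, §16.4] -/
theorem oneDim_mul_kU (k m : ℤ) (s : ℂ) {x : Matrix (Fin 2 ⊕ Fin 2) (Fin 2 ⊕ Fin 2) ℂ} (hx : xᴴ * Matrix.J (Fin 2) ℂ * x = Matrix.J (Fin 2) ℂ) {u : Matrix (Fin 2) (Fin 2) ℂ} (hu : uᴴ * u = 1) :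
    (fun h : Matrix (Fin 2 ⊕ Fin 2) (Fin 2 ⊕ Fin 2) ℂ => archScalarSection k s h * ((denom h (I • (1 : Matrix (Fin 2) (Fin 2) ℂ))).det / (denom h (-(I • (1 : Matrix (Fin 2) (Fin 2) ℂ)))).det) ^ (k + m)) (x * ((2 : ℂ)⁻¹ • fromBlocks (1 + u) (-(I • (1 - u))) (I • (1 - u)) (1 + u) : Matrix (Fin 2 ⊕ Fin 2) (Fin 2 ⊕ Fin 2) ℂ)) =
      u.det ^ m * (fun h : Matrix (Fin 2 ⊕ Fin 2) (Fin 2 ⊕ Fin 2) ℂ => archScalarSection k s h * ((denom h (I • (1 : Matrix (Fin 2) (Fin 2) ℂ))).det / (denom h (-(I • (1 : Matrix (Fin 2) (Fin 2) ℂ)))).det) ^ (k + m)) x := by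
  have hu0 : u.det ≠ 0 := det_ne_zero_of_unitary hu
  beta_reduce
  rw [archScalarSection_mul_stab k s hx (kU_mem_UJ hu) (moeb_kU_I (isUnit_iff_ne_zero.2 hu0)), denom_kU_I, ratio_mul_kU x hu, mul_zpow,
    show u.det ^ m = u.det ^ (-k) * u.det ^ (k + m) by rw [← zpow_add₀ hu0]; congr 1; ring]
  ring

/-- **`M_w(s) F_{k,m}(1) = (1∕8) · ξ(1, 0; s+1−k∕2−m, s+1+k∕2+m)`** (every `s`; the Bochner conventions agree on both sides): ★ (A∞-B) chart change `integral_hermOfReal_eq`,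
pointwise ★ `integrand_eq` × §1 `xiTwoIntegrand_mul_ratio_zpow` with `t = k+m`. [Shimura1982, (1.25), (1.31)] -/
theorem archIntertwining_oneDim_one (k m : ℤ) (s : ℂ) :
    archIntertwining (fun h : Matrix (Fin 2 ⊕ Fin 2) (Fin 2 ⊕ Fin 2) ℂ => archScalarSection k s h * ((denom h (I • (1 : Matrix (Fin 2) (Fin 2) ℂ))).det / (denom h (-(I • (1 : Matrix (Fin 2) (Fin 2) ℂ)))).det) ^ (k + m)) 1 =
      (1 / 8 : ℂ) * xiTwo 1 0 (s + 1 - k / 2 - m) (s + 1 + k / 2 + m) := by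
  have hpt : ∀ X : Matrix (Fin 2) (Fin 2) ℂ, (fun h : Matrix (Fin 2 ⊕ Fin 2) (Fin 2 ⊕ Fin 2) ℂ => archScalarSection k s h * ((denom h (I • (1 : Matrix (Fin 2) (Fin 2) ℂ))).det / (denom h (-(I • (1 : Matrix (Fin 2) (Fin 2) ℂ)))).det) ^ (k + m))
      (Matrix.J (Fin 2) ℂ * fromBlocks 1 X 0 1 * 1) = (X + I • (1 : Matrix (Fin 2) (Fin 2) ℂ)).det ^ (-k) * (((‖(X + I • (1 : Matrix (Fin 2) (Fin 2) ℂ)).det‖ : ℝ) : ℂ) ^ ((k : ℂ) - 2 * s - 2)) *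
        ((X + I • (1 : Matrix (Fin 2) (Fin 2) ℂ)).det / (X - I • (1 : Matrix (Fin 2) (Fin 2) ℂ)).det) ^ (k + m) := by
    intro X
    beta_reduce
    rw [archScalarSection_apply, ratio_J_transl, denom_J_mul_transl_one, Fintype.card_fin, Nat.cast_ofNat]
  have hα : (s + 1 + k / 2 : ℂ) - ((k + m : ℤ) : ℂ) = s + 1 - k / 2 - m := by push_cast; ring
  have hβ : (s + 1 - k / 2 : ℂ) + ((k + m : ℤ) : ℂ) = s + 1 + k / 2 + m := by push_cast; ring
  rw [archIntertwining_apply, funext fun r => hpt (hermOfReal r), xiTwo_def,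
    integral_hermOfReal_eq (fun X => (X + I • (1 : Matrix (Fin 2) (Fin 2) ℂ)).det ^ (-k) * (((‖(X + I • (1 : Matrix (Fin 2) (Fin 2) ℂ)).det‖ : ℝ) : ℂ) ^ ((k : ℂ) - 2 * s - 2)) *
      ((X + I • (1 : Matrix (Fin 2) (Fin 2) ℂ)).det / (X - I • (1 : Matrix (Fin 2) (Fin 2) ℂ)).det) ^ (k + m))]
  congr 1
  refine integral_congr_ae (Filter.Eventually.of_forall fun c => ?_)
  beta_reduce
  rw [integrand_eq k s c, xiTwoIntegrand_mul_ratio_zpow, hα, hβ]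

/-- `M_w(s) F_{k,m}(k_u) = det u^m · M_w(s) F_{k,m}(1)` for unitary `u` (§3 `oneDim_mul_kU` under the integral). [Shimura1997, §16.4] -/
theorem archIntertwining_oneDim_kU (k m : ℤ) (s : ℂ) {u : Matrix (Fin 2) (Fin 2) ℂ} (hu : uᴴ * u = 1) :
    archIntertwining (fun h : Matrix (Fin 2 ⊕ Fin 2) (Fin 2 ⊕ Fin 2) ℂ => archScalarSection k s h * ((denom h (I • (1 : Matrix (Fin 2) (Fin 2) ℂ))).det / (denom h (-(I • (1 : Matrix (Fin 2) (Fin 2) ℂ)))).det) ^ (k + m)) ((2 : ℂ)⁻¹ • fromBlocks (1 + u) (-(I • (1 - u))) (I • (1 - u)) (1 + u) : Matrix (Fin 2 ⊕ Fin 2) (Fin 2 ⊕ Fin 2) ℂ) =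
      u.det ^ m * archIntertwining (fun h : Matrix (Fin 2 ⊕ Fin 2) (Fin 2 ⊕ Fin 2) ℂ => archScalarSection k s h * ((denom h (I • (1 : Matrix (Fin 2) (Fin 2) ℂ))).det / (denom h (-(I • (1 : Matrix (Fin 2) (Fin 2) ℂ)))).det) ^ (k + m)) 1 := by
  rw [archIntertwining_apply, archIntertwining_apply, ← integral_const_mul]
  refine integral_congr_ae (Filter.Eventually.of_forall fun r => ?_)
  beta_reduce
  rw [Matrix.mul_one]
  exact oneDim_mul_kU k m s (J_mul_transl_hermOfReal_mem r) hu

/-! ## §4  The anchor triple at the type `(0, m)` -/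

/-- **THE ONE-DIMENSIONAL ANCHOR** (`re s > ½`, any `k m : ℤ`): there is `F ∈ I_w(s,χ_k)` with `cp F = D^m` and
`cp M_w(s) F = c_{k,m}(s) • D^m`, `c_{k,m}(s) = (1∕8)·(4π⁴·e^{iπ(k+2m)}·Γ₂(s+1−k∕2−m)⁻¹·Γ₂(s+1+k∕2+m)⁻¹·(Γ₂(2s)·4^{−2s}))` (`Γ₂ = hermTwoGamma`; `m = −k` is ★ `anchor`'s
`c_k(s)`).  The anchor of ★ asm FILE 2 `ladder` ∕ FILE 4 `ladder_pair` at EVERY one-dimensional type. [Shimura1982, (1.31), Case II, m = 2] [LeeZhu1998, §5] -/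
theorem oneDim_anchor (k m : ℤ) {s : ℂ} (hs : 1 / 2 < s.re) :
    ∃ F : Matrix (Fin 2 ⊕ Fin 2) (Fin 2 ⊕ Fin 2) ℂ → ℂ, IsArchSiegelSection (fun z : ℂ => (conj z / ((‖z‖ : ℝ) : ℂ)) ^ k) s F ∧
      (∀ (v : Matrix (Fin 2) (Fin 2) ℂ), vᴴ * v = 1 → ∀ hv : v.det ≠ 0, F ((2 : ℂ)⁻¹ • fromBlocks (1 + v) (-(I • (1 - v))) (I • (1 - v)) (1 + v) : Matrix (Fin 2 ⊕ Fin 2) (Fin 2 ⊕ Fin 2) ℂ) = evalAt v hv (dz m)) ∧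
      (∀ (u : Matrix (Fin 2) (Fin 2) ℂ), uᴴ * u = 1 → ∀ hu' : u.det ≠ 0,
        archIntertwining F ((2 : ℂ)⁻¹ • fromBlocks (1 + u) (-(I • (1 - u))) (I • (1 - u)) (1 + u) : Matrix (Fin 2 ⊕ Fin 2) (Fin 2 ⊕ Fin 2) ℂ) = evalAt u hu'
          (((1 / 8 : ℂ) * (((4 * Real.pi ^ 4 : ℝ) : ℂ) * cexp ((Real.pi * I) * (k + 2 * m)) * (hermTwoGamma (s + 1 - k / 2 - m))⁻¹ *
            (hermTwoGamma (s + 1 + k / 2 + m))⁻¹ * (hermTwoGamma (2 * s) * (4 : ℂ) ^ (-(2 * s))))) • dz m)) := by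
  have hαβ : 3 < ((s + 1 - k / 2 - m) + (s + 1 + k / 2 + m)).re := by
    have : ((s + 1 - k / 2 - m) + (s + 1 + k / 2 + m) : ℂ) = 2 * s + 2 := by ring
    rw [this, Complex.add_re, Complex.mul_re]
    norm_num
    linarith
  have hdet : ((2 : ℂ) • (1 : Matrix (Fin 2) (Fin 2) ℂ)).det = 4 := by
    rw [det_smul, det_one, mul_one, Fintype.card_fin]
    norm_num
  have e1 : (Real.pi * I) * ((s + 1 + k / 2 + m) - (s + 1 - k / 2 - m)) = (Real.pi * I) * (k + 2 * m) := by ring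
  have e2 : ((s + 1 - k / 2 - m) + (s + 1 + k / 2 + m) - 2 : ℂ) = 2 * s := by ring
  refine ⟨_, isArchSiegelSection_oneDim k m s, fun v hv hv' => oneDim_kU k m s hv hv', fun u hu hu' => ?_⟩
  rw [archIntertwining_oneDim_kU k m s hu, archIntertwining_oneDim_one, xiTwo_zero_right Matrix.PosDef.one hαβ, hdet, e1, e2, map_smul, evalAt_dz,
    smul_eq_mul, mul_comm]

end Summit.HodgeConjecture.HodgeConjecture.Cruxes.HLiu418.K2LiuArchOneDimAnchors

end
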